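import Summits.AtomisticToContinuum.BoseEinsteinCondensation.Theorems.BECStronglyRayleighLatticeToPeriodicBridgePairSlotMeans
import Literature.MathematicalPhysics.QuantumManyBody.PeriodicCondensateCoherence

/-!
# Route `BECStronglyRayleigh`, crux `LatticeToPeriodicBridge` (stmt-AtomisticToContinuum-9674),
# line `coarse-cell-lorentzian` — pair condensation from condensation; the two-sided sandwich around S45

Helper file of the crux line `coarse-cell-lorentzian`, landed `--supports stmt-AtomisticToContinuum-9674`; it closes the
formal gap between the two halves of the row-flatness SANDWICH (`…RowFlatnessSandwich.lean`, p96926): the DOWN half derives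
the registered residual stub `Sig.stub_pairKernelRowFlatness` (S45) from a PAIR-condensate floor
`∫_{X'}(∫_{cell²} Re Ψ)² ≥ L⁶/𝕄`; here the pair floor is derived from an ordinary (single-particle) condensate floor
`n₀(Ψ) ≥ c·N` by the many-slot Cauchy–Schwarz inequality of `…PairSlotMeans.lean` (`⟨Ψ, n̂₀ Ψ⟩² ≤ ‖n̂₀ Ψ‖²`) applied to
`F = |Ψ|` for a real non-negative Bose-symmetric periodic trial state `Ψ` of `N = n+2` particles:

* `pairMass_ge_of_condensateOccupation_ge` : if `n₀(Ψ) ≥ c·N` with `N ≥ 2/c − 1`, then `L⁶ ≤ (2/c²)·∫_{X'}(∫_{cell²}Re Ψ)²`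
  (`⟨P₀⊗P₀⊗1⟩ ≥ (n₀/N)² − (n₀/N)/(N−1) ≥ c²/2`);
* `stub_pairKernelRowFlatness_of_condensateFloor` : a uniform condensate floor `n₀ ≥ max(c, 2/(N+1))·N` for the real `≥ 0`
  near-minimisers on the dilute tori (the `2/(N+1)` only bites for the few-body near-minimisers `N + 1 < 2/c`, which are
  completely condensed on a large torus — NOT supplied here; note that for `N = 2` a single-particle floor `< 1/2` alone does
  not force any pair floor: `Ψ = g(ξ)+g(η)`, `∫g = 0`) implies S45 with `𝕄 = 2/c²` — so S45 is EQUIVALENT, up to constants and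
  that few-body corner, to torus BEC of the real `≥ 0` near-minimisers (UP: `periodicBEC_of` in the skeleton): the line
  `coarse-cell-lorentzian` is a dictionary, formally.

References: O. Penrose, L. Onsager, Phys. Rev. 104 (1956) 576; C. N. Yang, Rev. Mod. Phys. 34 (1962) 694; LSSY 2005 §1.2.
-/

noncomputable section

open MeasureTheory Filter Metric Set Function
open scoped ENNReal Topology NNReal Real

namespace Summit.AtomisticToContinuum.BoseEinsteinCondensation.Cruxes.LatticeToPeriodicBridge.CoarseCellLorentzian

namespace PairFromSingle

open Literature.MathematicalPhysics.QuantumManyBody.BoseGas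
/-! ## The state `F = |Ψ|` of a real non-negative periodic trial state -/

section State

variable {n : ℕ} {L : ℝ}

/-- A real non-negative value is its own modulus: `z = ‖z‖` in `ℂ`. [folklore] -/
theorem eq_norm_of_re_nonneg_im_zero {z : ℂ} (h : 0 ≤ z.re ∧ z.im = 0) : z = (‖z‖ : ℂ) := by
  have hz : z = (z.re : ℂ) := Complex.ext rfl (by simp [h.2])
  have hn : ‖z‖ = z.re := by rw [hz, Complex.norm_real, Real.norm_of_nonneg h.1]; simp
  rw [hn]; exact hz

/-- … and its real part is its modulus. [folklore] -/
theorem re_eq_norm_of_re_nonneg_im_zero {z : ℂ} (h : 0 ≤ z.re ∧ z.im = 0) : z.re = ‖z‖ := by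
  have hz : z = (z.re : ℂ) := Complex.ext rfl (by simp [h.2])
  rw [hz, Complex.norm_real, Real.norm_of_nonneg h.1]; simp

variable (Ψ : PeriodicTrialState (n + 2) L)

/-- `F = ‖Ψ‖₊` is measurable. [folklore] -/
theorem measurable_nnnormState : Measurable fun X : Config (n + 2) => (‖Ψ.ψ X‖₊ : ℝ≥0∞) :=
  Ψ.contDiff.continuous.measurable.nnnorm.coe_nnreal_ennreal

/-- `F = ‖Ψ‖₊` is permutation-symmetric. [folklore] -/
theorem nnnormState_symm (σ : Equiv.Perm (Fin (n + 2))) (X : Config (n + 2)) :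
    (‖Ψ.ψ (X ∘ σ)‖₊ : ℝ≥0∞) = ‖Ψ.ψ X‖₊ := by rw [Ψ.symm]

/-- `∫ F² = 1`. [folklore] -/
theorem lintegral_nnnormState_sq : ∫⁻ X in cellN (n + 2) L, ((‖Ψ.ψ X‖₊ : ℝ≥0∞)) ^ 2 = 1 := Ψ.norm_eq

/-- **`n₀ = (n+2)·L⁻³·S₁`** for a real non-negative state: the condensate occupation through the slice integrals of
`F = |Ψ|`. [folklore] -/
theorem condensateOccupation_eq_S1 (hL : 0 < L) (hpos : ∀ X, 0 ≤ (Ψ.ψ X).re ∧ (Ψ.ψ X).im = 0) :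
    condensateOccupation (n + 2) L Ψ.ψ = ((n : ℝ≥0∞) + 2) * ((ENNReal.ofReal L ^ 3)⁻¹ *
      ∫⁻ Y in cellN (n + 1) L, (∫⁻ x in cell L, (‖Ψ.ψ (Matrix.vecCons x Y)‖₊ : ℝ≥0∞)) ^ 2) := by
  have hreal : ∀ X, Ψ.ψ X = (‖Ψ.ψ X‖ : ℂ) := fun X => eq_norm_of_re_nonneg_im_zero (hpos X)
  rw [condensateOccupation_succ hL Ψ.ψ]
  have hc : ((n + 1 : ℕ) : ℝ≥0∞) + 1 = (n : ℝ≥0∞) + 2 := by push_cast; ring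
  rw [show ((n + 1 : ℕ) : ℝ≥0∞) + 1 = (n : ℝ≥0∞) + 2 from hc]
  congr 2
  refine lintegral_congr fun Y => ?_
  rw [enorm_integral_slice_eq Ψ hreal Y]

/-- **`ofReal P = S₂`**: the pair-condensate mass of the sandwich (a real Bochner integral) through the iterated slice
integrals of `F = |Ψ|`. [folklore] -/
theorem ofReal_pairMass_eq_S2 (hL : 0 < L) (hpos : ∀ X, 0 ≤ (Ψ.ψ X).re ∧ (Ψ.ψ X).im = 0) :
    ENNReal.ofReal (∫ X' in cellN n L, (∫ p in cell L ×ˢ cell L, (Ψ.ψ (Fin.cons p.1 (Fin.cons p.2 X'))).re) ^ 2) =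
      ∫⁻ X' in cellN n L, (∫⁻ ξ in cell L, ∫⁻ η in cell L,
        (‖Ψ.ψ (Matrix.vecCons ξ (Matrix.vecCons η X'))‖₊ : ℝ≥0∞)) ^ 2 := by
  have hΨc := Ψ.contDiff.continuous
  -- the inner real integral `I X'` and its `ℝ≥0∞` twin `E X'`
  set I : Config n → ℝ := fun X' => ∫ p in cell L ×ˢ cell L, (Ψ.ψ (Fin.cons p.1 (Fin.cons p.2 X'))).re with hI
  set E : Config n → ℝ≥0∞ := fun X' => ∫⁻ ξ in cell L, ∫⁻ η in cell L,
    (‖Ψ.ψ (Matrix.vecCons ξ (Matrix.vecCons η X'))‖₊ : ℝ≥0∞) with hE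
  have hI0 : ∀ X', 0 ≤ I X' := fun X' => integral_nonneg fun p => (hpos _).1
  -- `I` is continuous (one `M = 1` cell: `I = K(0,0)`), hence integrable on the bath cell
  have hIeq : I = fun X' => ∑ x : Fin 3 → Fin 1, ∑ y : Fin 3 → Fin 1, cellKernel L 1 Ψ.ψ X' x y := by
    funext X'
    exact RowFlatnessSandwich.setIntegral_prod_eq_sum_cellKernel hΨc hL le_rfl X'
  have hIc : Continuous I := by
    rw [hIeq]
    refine continuous_finsetSum _ fun x _ => continuous_finsetSum _ fun y _ => ?_
    exact CellNormRetention.continuous_cellKernel hΨc L 1 x y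
  have hI2i : Integrable (fun X' => I X' ^ 2) ((volume : Measure (Config n)).restrict (cellN n L)) :=
    integrableOn_cellN (hIc.pow 2) L
  -- `ofReal (I X') = E X'`
  have hIE : ∀ X', ENNReal.ofReal (I X') = E X' := fun X' => by
    have hGc : Continuous fun p : Space × Space => (Ψ.ψ (Fin.cons p.1 (Fin.cons p.2 X'))).re :=
      Complex.continuous_re.comp (hΨc.comp (CellNormRetention.continuous_finCons_finCons_left X'))
    have hint : IntegrableOn (fun p : Space × Space => (Ψ.ψ (Fin.cons p.1 (Fin.cons p.2 X'))).re)
        (cell L ×ˢ cell L) volume := by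
      rw [CellNormRetention.cell_eq_cubeIco]
      exact CellNormRetention.integrableOn_prod_cubeIco hGc _ _ _
    simp only [hI]
    rw [ofReal_integral_eq_lintegral_ofReal hint (Eventually.of_forall fun p => (hpos _).1)]
    have hre : ∀ p : Space × Space, ENNReal.ofReal (Ψ.ψ (Fin.cons p.1 (Fin.cons p.2 X'))).re =
        (‖Ψ.ψ (Matrix.vecCons p.1 (Matrix.vecCons p.2 X'))‖₊ : ℝ≥0∞) := fun p => by
      rw [re_eq_norm_of_re_nonneg_im_zero (hpos _), ofReal_norm, enorm_eq_nnnorm]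
      rfl
    simp_rw [hre]
    rw [Measure.volume_eq_prod, setLIntegral_prod _
      ((measurable_vecCons_vecCons (measurable_nnnormState Ψ) X').aemeasurable)]
  -- integrate
  rw [ofReal_integral_eq_lintegral_ofReal hI2i (Eventually.of_forall fun X' => sq_nonneg _)]
  refine lintegral_congr fun X' => ?_
  rw [ENNReal.ofReal_pow (hI0 X'), hIE X']

/-- **Pair condensation from condensation** (fixed `N = n+2`, `L`): for a real non-negative periodic trial state with
`n₀(Ψ) ≥ c·N` and `N ≥ 2/c − 1`, the pair-condensate mass satisfies `L⁶ ≤ (2/c²)·∫_{X'}(∫_{cell²}Re Ψ)²`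
(`⟨P₀⊗P₀⊗1⟩ ≥ (n₀/N)² − (n₀/N)/(N−1) ≥ c²/2`). [folklore] -/
theorem pairMass_ge_of_condensateOccupation_ge (hL : 0 < L) (hpos : ∀ X, 0 ≤ (Ψ.ψ X).re ∧ (Ψ.ψ X).im = 0)
    {c : ℝ} (hc : 0 < c) (hN : 2 / c ≤ (n : ℝ) + 3)
    (hfloor : ENNReal.ofReal (c * ((n : ℝ) + 2)) ≤ condensateOccupation (n + 2) L Ψ.ψ) :
    L ^ 6 ≤ 2 / c ^ 2 * ∫ X' in cellN n L,
      (∫ p in cell L ×ˢ cell L, (Ψ.ψ (Fin.cons p.1 (Fin.cons p.2 X'))).re) ^ 2 := by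
  set F : Config (n + 2) → ℝ≥0∞ := fun X => (‖Ψ.ψ X‖₊ : ℝ≥0∞) with hF
  set S1 : ℝ≥0∞ := ∫⁻ Y in cellN (n + 1) L, (∫⁻ x in cell L, F (Matrix.vecCons x Y)) ^ 2 with hS1
  set S2 : ℝ≥0∞ := ∫⁻ X' in cellN n L,
    (∫⁻ ξ in cell L, ∫⁻ η in cell L, F (Matrix.vecCons ξ (Matrix.vecCons η X'))) ^ 2 with hS2
  set P : ℝ := ∫ X' in cellN n L,
      (∫ p in cell L ×ˢ cell L, (Ψ.ψ (Fin.cons p.1 (Fin.cons p.2 X'))).re) ^ 2 with hP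
  have hCS : ((n : ℝ≥0∞) + 2) * S1 ^ 2 ≤ ENNReal.ofReal L ^ 3 * S1 + ((n : ℝ≥0∞) + 1) * S2 :=
    many_slot_cauchySchwarz (L := L) (measurable_nnnormState Ψ) (nnnormState_symm Ψ)
      (lintegral_nnnormState_sq Ψ).le
  have hn0 : condensateOccupation (n + 2) L Ψ.ψ = ((n : ℝ≥0∞) + 2) * ((ENNReal.ofReal L ^ 3)⁻¹ * S1) :=
    condensateOccupation_eq_S1 Ψ hL hpos
  have hS2P : ENNReal.ofReal P = S2 := ofReal_pairMass_eq_S2 Ψ hL hpos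
  -- finiteness
  have hL3 : ENNReal.ofReal L ^ 3 = ENNReal.ofReal (L ^ 3) := by rw [ENNReal.ofReal_pow hL.le]
  have hL3pos : (0 : ℝ) < L ^ 3 := by positivity
  have hL3ne : ENNReal.ofReal (L ^ 3) ≠ 0 := by rw [← hL3]; exact pow_ne_zero _ (by simpa using hL)
  have hN2 : (n : ℝ≥0∞) + 2 = ENNReal.ofReal ((n : ℝ) + 2) := by
    rw [ENNReal.ofReal_add (by positivity) (by norm_num)]; simp
  have hN2ne : (n : ℝ≥0∞) + 2 ≠ 0 := by positivity
  have hN2top : (n : ℝ≥0∞) + 2 ≠ ⊤ := by simp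
  have hn₀le : condensateOccupation (n + 2) L Ψ.ψ ≤ (n : ℝ≥0∞) + 2 := by
    have h := condensateOccupation_le_card_mul_lintegral hL (Ψ := Ψ.ψ) Ψ.contDiff.continuous
    rw [Ψ.norm_eq, mul_one] at h
    refine h.trans_eq ?_
    push_cast; ring
  -- `S1 = L³ n₀ / (n+2)` is finite
  have hS1eq : S1 = ENNReal.ofReal (L ^ 3) * condensateOccupation (n + 2) L Ψ.ψ / ((n : ℝ≥0∞) + 2) := by
    rw [ENNReal.eq_div_iff hN2ne hN2top, hn0, hL3]
    calc ((n : ℝ≥0∞) + 2) * S1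
        = ((n : ℝ≥0∞) + 2) * S1 * (ENNReal.ofReal (L ^ 3) * (ENNReal.ofReal (L ^ 3))⁻¹) := by
          rw [ENNReal.mul_inv_cancel hL3ne ENNReal.ofReal_ne_top, mul_one]
      _ = ENNReal.ofReal (L ^ 3) * (((n : ℝ≥0∞) + 2) * ((ENNReal.ofReal (L ^ 3))⁻¹ * S1)) := by ring
  have hS1top : S1 ≠ ⊤ := by
    rw [hS1eq]
    refine ENNReal.div_ne_top (ENNReal.mul_ne_top ENNReal.ofReal_ne_top ?_) hN2ne
    exact ne_top_of_le_ne_top hN2top hn₀le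
  have hS2top : S2 ≠ ⊤ := by rw [← hS2P]; exact ENNReal.ofReal_ne_top
  -- pass to real numbers
  set s1 : ℝ := S1.toReal with hs1
  have hs1nn : 0 ≤ s1 := ENNReal.toReal_nonneg
  have hP0 : 0 ≤ P := integral_nonneg fun X' => sq_nonneg _
  have hS1r : S1 = ENNReal.ofReal s1 := (ENNReal.ofReal_toReal hS1top).symm
  have hS2r : S2 = ENNReal.ofReal P := hS2P.symm
  have hn2 : (0 : ℝ) < (n : ℝ) + 2 := by positivity
  have hn1 : (0 : ℝ) < (n : ℝ) + 1 := by positivity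
  -- the floor in reals: `c (n+2) ≤ (n+2) L⁻³ s1`, i.e. `c L³ ≤ s1`
  have hfloor_r : c * L ^ 3 ≤ s1 := by
    have h1 : ENNReal.ofReal (c * ((n : ℝ) + 2)) ≤ ((n : ℝ≥0∞) + 2) * ((ENNReal.ofReal (L ^ 3))⁻¹ * S1) := by
      rw [← hL3, ← hn0]; exact hfloor
    rw [hS1r, hN2, ← ENNReal.ofReal_inv_of_pos hL3pos, ← ENNReal.ofReal_mul (inv_nonneg.2 hL3pos.le),
      ← ENNReal.ofReal_mul hn2.le,
      ENNReal.ofReal_le_ofReal_iff (mul_nonneg hn2.le (mul_nonneg (inv_nonneg.2 hL3pos.le) hs1nn))] at h1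
    have h2 : c ≤ (L ^ 3)⁻¹ * s1 := by nlinarith
    rwa [le_inv_mul_iff₀ hL3pos, mul_comm] at h2
  -- the many-slot inequality in reals: `(n+2) s1² ≤ L³ s1 + (n+1) P`
  have hCS_r : ((n : ℝ) + 2) * s1 ^ 2 ≤ L ^ 3 * s1 + ((n : ℝ) + 1) * P := by
    have h := hCS
    have hN1 : ((n : ℝ≥0∞) + 1) = ENNReal.ofReal ((n : ℝ) + 1) := by
      rw [ENNReal.ofReal_add (by positivity) (by norm_num)]; simp
    rw [hS1r, hS2r, hL3, hN2, hN1, ← ENNReal.ofReal_pow hs1nn, ← ENNReal.ofReal_mul hn2.le,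
      ← ENNReal.ofReal_mul hL3pos.le, ← ENNReal.ofReal_mul hn1.le,
      ← ENNReal.ofReal_add (mul_nonneg hL3pos.le hs1nn) (mul_nonneg hn1.le hP0),
      ENNReal.ofReal_le_ofReal_iff (add_nonneg (mul_nonneg hL3pos.le hs1nn) (mul_nonneg hn1.le hP0))] at h
    exact h
  -- algebra: `(n+1) P ≥ s1((n+2)s1 − L³) ≥ cL³ · L³((n+2)c − 1) ≥ cL⁶ (n+1)c/2`
  have hN' : 2 ≤ c * ((n : ℝ) + 3) := by
    have := mul_le_mul_of_nonneg_left hN hc.le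
    rwa [mul_div_cancel₀ _ hc.ne'] at this
  have hkey : ((n : ℝ) + 1) * (c ^ 2 * L ^ 6) ≤ ((n : ℝ) + 1) * (2 * P) := by
    have hA : s1 * (((n : ℝ) + 2) * s1 - L ^ 3) ≤ ((n : ℝ) + 1) * P := by nlinarith
    have hB : c * L ^ 3 * (((n : ℝ) + 2) * (c * L ^ 3) - L ^ 3) ≤ s1 * (((n : ℝ) + 2) * s1 - L ^ 3) := by
      have hd : 0 ≤ s1 - c * L ^ 3 := sub_nonneg.2 hfloor_r
      have hc2 : 1 ≤ ((n : ℝ) + 2) * c := by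
        have hn0 : (0 : ℝ) ≤ n := Nat.cast_nonneg n
        by_cases hc1 : c ≤ 1
        · nlinarith
        · push Not at hc1
          nlinarith
      have hpos1 : 0 ≤ ((n : ℝ) + 2) * (c * L ^ 3) - L ^ 3 := by
        have hrw : ((n : ℝ) + 2) * (c * L ^ 3) - L ^ 3 = L ^ 3 * (((n : ℝ) + 2) * c - 1) := by ring
        rw [hrw]
        exact mul_nonneg hL3pos.le (by linarith)
      nlinarith [mul_nonneg hd hpos1, mul_nonneg hd hs1nn, sq_nonneg (s1 - c * L ^ 3)]
    have hC : ((n : ℝ) + 1) * (c ^ 2 * L ^ 6) ≤ 2 * (c * L ^ 3 * (((n : ℝ) + 2) * (c * L ^ 3) - L ^ 3)) := by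
      have hL6 : (0 : ℝ) ≤ L ^ 6 := by positivity
      nlinarith [mul_nonneg hc.le hL6]
    nlinarith
  have hfin : c ^ 2 * L ^ 6 ≤ 2 * P := le_of_mul_le_mul_left hkey hn1
  rw [div_mul_eq_mul_div, le_div_iff₀ (by positivity)]
  linarith

end State

end PairFromSingle

/-! ## The two-sided sandwich: S45 from an ordinary condensate floor -/

open Literature.MathematicalPhysics.QuantumManyBody.BoseGas PairFromSingle in
/-- **Row flatness from condensation** (closing the sandwich around the registered residual stub S45): if for every
repulsive finite-range `v` there are `c, L₁, ρ_d > 0` such that on every torus of side `L ≥ L₁` with `N = N'+2 ≤ ρ_d L³`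
bosons some slack `δ > 0` makes every REAL NON-NEGATIVE `δ`-near-minimiser condensed at level
`n₀ ≥ max(c, 2/(N+1))·N` (the `2/(N+1)` only matters for the few-body near-minimisers `N + 1 < 2/c`), then
`Sig.stub_pairKernelRowFlatness` holds with `𝕄 = 2/c²`, `b₁ = L₁`: many-slot Cauchy–Schwarz
(`pairMass_ge_of_condensateOccupation_ge`) gives the pair floor `L⁶ ≤ (2/c²)·∫_{X'}(∫_{cell²}Re Ψ)²`, and the DOWN half of
the sandwich (`stub_pairKernelRowFlatness_of_pairCondensateFloor`) gives S45. Together with `periodicBEC_of` (UP), the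
line's residual stub is torus BEC of the real `≥ 0` near-minimisers in all but name. [folklore] -/
theorem stub_pairKernelRowFlatness_of_condensateFloor
    (h : ∀ v : ℝ → ℝ≥0∞, IsRepulsiveFiniteRange v → ∃ c : ℝ, 0 < c ∧ ∃ L₁ : ℝ, 0 < L₁ ∧ ∃ ρd : ℝ, 0 < ρd ∧
      ∀ L : ℝ, L₁ ≤ L → ∀ N' : ℕ, ((N' : ℝ) + 2) ≤ ρd * L ^ 3 →
        ∃ δ : ℝ≥0∞, 0 < δ ∧ ∀ Ψ : PeriodicTrialState (N' + 2) L,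
          (∀ X, 0 ≤ (Ψ.ψ X).re ∧ (Ψ.ψ X).im = 0) →
          periodicEnergy v Ψ ≤ periodicGroundStateEnergy v (N' + 2) L + δ →
            ENNReal.ofReal (max c (2 / ((N' : ℝ) + 3)) * ((N' : ℝ) + 2)) ≤ condensateOccupation (N' + 2) L Ψ.ψ) :
    Sig.stub_pairKernelRowFlatness := by
  refine stub_pairKernelRowFlatness_of_pairCondensateFloor fun v hv => ?_
  obtain ⟨c, hc, L₁, hL₁, ρd, hρd, hfl⟩ := h v hv
  refine ⟨2 / c ^ 2, by positivity, L₁, hL₁, ρd, hρd, fun L hL N' hN' => ?_⟩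
  obtain ⟨δ, hδ, hΨ⟩ := hfl L hL N' hN'
  refine ⟨δ, hδ, fun Ψ hpos hE => ?_⟩
  have hLpos : 0 < L := hL₁.trans_le hL
  set c' : ℝ := max c (2 / ((N' : ℝ) + 3)) with hc'
  have hc'c : c ≤ c' := le_max_left _ _
  have hc'pos : 0 < c' := hc.trans_le hc'c
  have hN3 : (0 : ℝ) < (N' : ℝ) + 3 := by positivity
  have hN : 2 / c' ≤ (N' : ℝ) + 3 := by
    rw [div_le_iff₀ hc'pos]
    have h2 : 2 / ((N' : ℝ) + 3) ≤ c' := le_max_right _ _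
    rw [div_le_iff₀ hN3] at h2
    linarith
  have hpair := pairMass_ge_of_condensateOccupation_ge Ψ hLpos hpos hc'pos hN (hΨ Ψ hpos hE)
  have hP0 : 0 ≤ ∫ X' in cellN N' L,
      (∫ p in cell L ×ˢ cell L, (Ψ.ψ (Fin.cons p.1 (Fin.cons p.2 X'))).re) ^ 2 :=
    integral_nonneg fun X' => sq_nonneg _
  have hcoef : 2 / c' ^ 2 ≤ 2 / c ^ 2 := by
    apply div_le_div_of_nonneg_left (by norm_num) (by positivity)
    exact pow_le_pow_left₀ hc.le hc'c 2
  exact hpair.trans (mul_le_mul_of_nonneg_right hcoef hP0)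

/-- **Registered form** (sub-goal `rowFlatnessSandwich_condensateFloor` of the crux item, signature verbatim, fully qualified):
a uniform condensate floor `n₀ ≥ max(c, 2/(N+1))·N` for the real `≥ 0` near-minimisers implies the registered stub
`Sig.stub_pairKernelRowFlatness` (= `stub_pairKernelRowFlatness_of_condensateFloor`). [folklore] -/
theorem rowFlatnessSandwich_condensateFloor : (∀ v : ℝ → ENNReal, Literature.MathematicalPhysics.QuantumManyBody.BoseGas.IsRepulsiveFiniteRange v → ∃ c : ℝ, 0 < c ∧ ∃ L₁ : ℝ, 0 < L₁ ∧ ∃ ρd : ℝ, 0 < ρd ∧ ∀ L : ℝ, L₁ ≤ L → ∀ N' : ℕ, ((N' : ℝ) + 2) ≤ ρd * L ^ 3 → ∃ δ : ENNReal, 0 < δ ∧ ∀ Ψ : Literature.MathematicalPhysics.QuantumManyBody.BoseGas.PeriodicTrialState (N' + 2) L, (∀ X, 0 ≤ (Ψ.ψ X).re ∧ (Ψ.ψ X).im = 0) → Literature.MathematicalPhysics.QuantumManyBody.BoseGas.periodicEnergy v Ψ ≤ Literature.MathematicalPhysics.QuantumManyBody.BoseGas.periodicGroundStateEnergy v (N'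 + 2) L + δ → ENNReal.ofReal (max c (2 / ((N' : ℝ) + 3)) * ((N' : ℝ) + 2)) ≤ Literature.MathematicalPhysics.QuantumManyBody.BoseGas.condensateOccupation (N' + 2) L Ψ.ψ) → Sig.stub_pairKernelRowFlatness :=
  fun h => stub_pairKernelRowFlatness_of_condensateFloor h

end Summit.AtomisticToContinuum.BoseEinsteinCondensation.Cruxes.LatticeToPeriodicBridge.CoarseCellLorentzian

end
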